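import Literature.Analysis.FluidPDE.MollifiedNSRTriple
import Literature.Analysis.FluidPDE.TorusLpOperatorFactsAntidivergenceProofs
import Literature.Analysis.FunctionSpaces.TorusHolderBridge
import HarnessLib

/-!
# Bounds for the reparametrised mollified Navier–Stokes–Reynolds triple

Analysis/FluidPDE support file (everything proved), the quantitative companion of
`MollifiedNSRTriple` (Buckmaster–Vicol, Ann. of Math. 189 (2019), §4.1 (4.4)–(4.7); EMS Surv. 6 (2019),
§7.3 (7.7)–(7.10)): Lipschitz slab data from `C¹_{x,t}` sup bounds, the `H`-based bound on `∂ₜV`,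
the `L¹` bound of mollified data, and the resulting sup/`L¹` bounds for the reparametrised velocity,
the commutator stress, the reparametrisation defect and the mollified stress.

## References

* T. Buckmaster, V. Vicol, Ann. of Math. 189 (2019) = arXiv:1709.10033, §4.1 (4.4)–(4.7). [`BuckmasterVicol2019Annals`]
* T. Buckmaster, V. Vicol, EMS Surv. Math. Sci. 6 (2019) = arXiv:1901.09023, §7.3 (7.7)–(7.10). [`BuckmasterVicol2020`]
-/

noncomputable section

open MeasureTheory TopologicalSpace Set Function Filter Metric ContinuousLinearMap
open _root_.Topology
open scoped ENNReal NNReal Convolution InnerProductSpace ContDiff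

namespace Literature.Analysis.FluidPDE

namespace Torus

open FunctionSpaces.Torus (stLift lift kernel IsSmooth IsContDiff IsDivFree HasZeroMean mollifiedField vecMollify
  timeBump timeBumpDerivMass gradProfileMass derivProfileMass)
open FunctionSpaces (timeAvgWith)

variable {d : Type*} [Fintype d] [DecidableEq d]

/-! ## Lipschitz slab data from `C¹_{x,t}` sup bounds -/

section SlabData

variable {T : ℝ} {v : ℝ → UnitAddTorus d → EuclideanSpace ℝ d} {B₀ B₁ Bt : ℝ}

/-- **A field with `C¹_{x,t}` sup bounds on `[0, T] × 𝕋^d` gives Lipschitz (`β = 1`) slab data**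
after extension by zero: `‖v‖ ≤ B₀`, `‖∂ᵢv‖ ≤ B₁`, `‖∂ₜv‖ ≤ Bₜ` on the slab yield
`HolderSlabData (zeroExt T v) B₀ (Bₜ + √d · d · B₁) 1 T` (mean value in time on `[0, T]`, and in
space along good lifts, `Torus.lipschitzWith_of_norm_partialDeriv_le`). [folklore] -/
theorem holderSlabData_zeroExt (hT : 0 < T) (hv : FunctionSpaces.Torus.IsSmoothSpaceTimeOn (Icc 0 T) v)
    (h0 : ∀ t ∈ Icc 0 T, ∀ x, ‖v t x‖ ≤ B₀) (h1 : ∀ i, ∀ t ∈ Icc 0 T, ∀ x, ‖FunctionSpaces.Torus.partialDeriv i (v t) x‖ ≤ B₁)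
    (ht : ∀ t ∈ Icc 0 T, ∀ x, ‖FunctionSpaces.Torus.timeDerivWithin (Icc 0 T) v t x‖ ≤ Bt) (hB₁ : 0 ≤ B₁) (hBt : 0 ≤ Bt) :
    HolderSlabData (zeroExt T v) B₀ (Bt + Real.sqrt (Fintype.card d) * Fintype.card d * B₁) 1 T := by
  have hT0 : (0 : ℝ) ≤ T := hT.le
  have hM : 0 ≤ B₀ := (norm_nonneg _).trans (h0 0 ⟨le_rfl, hT0⟩ 0)
  set L : ℝ := Real.sqrt (Fintype.card d) * Fintype.card d * B₁ with hL
  have hL0 : 0 ≤ L := by positivity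
  refine
    { measurable := stronglyMeasurable_uncurry_zeroExt hT0 hv
      bound := norm_zeroExt_le hM h0
      zero_off := fun s hs => zeroExt_of_not_mem v hs
      holder := fun s hs s' hs' y y' => ?_
      H_nonneg := by positivity
      β_pos := one_pos
      β_le_one := le_rfl }
  rw [zeroExt_of_mem v hs, zeroExt_of_mem v hs', Real.rpow_one]
  -- time increment at fixed `y`
  have htime : ‖v s y - v s' y‖ ≤ Bt * |s - s'| := by
    have h := (convex_Icc (0 : ℝ) T).norm_image_sub_le_of_norm_hasDerivWithin_le (f := fun r => v r y)
      (f' := fun r => FunctionSpaces.Torus.timeDerivWithin (Icc 0 T) v r y)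
      (fun r hr => hv.hasDerivWithinAt_slice hr y) (fun r hr => ht r hr y) hs' hs
    simpa [Real.norm_eq_abs] using h
  -- space increment at fixed `s'`
  have hspace : ‖v s' y - v s' y'‖ ≤ L * ‖y - y'‖ := by
    have hLip := FunctionSpaces.Torus.lipschitzWith_of_norm_partialDeriv_le ((hv.isSmooth_slice hs').isContDiff (by simp))
      (M := fun _ : d => Real.toNNReal B₁) (fun i x => by rw [Real.coe_toNNReal B₁ hB₁]; exact h1 i s' hs' x)
    have h := hLip.dist_le_mul y y'
    rw [dist_eq_norm, dist_eq_norm] at h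
    refine h.trans (le_of_eq ?_)
    congr 1
    push_cast
    rw [Real.coe_toNNReal B₁ hB₁]
    simp only [Finset.sum_const, Finset.card_univ, nsmul_eq_mul]
    rw [hL, mul_assoc]
  calc ‖v s y - v s' y'‖ = ‖(v s y - v s' y) + (v s' y - v s' y')‖ := by rw [sub_add_sub_cancel]
    _ ≤ ‖v s y - v s' y‖ + ‖v s' y - v s' y'‖ := norm_add_le _ _
    _ ≤ Bt * |s - s'| + L * ‖y - y'‖ := add_le_add htime hspace
    _ ≤ Bt * max |s - s'| ‖y - y'‖ + L * max |s - s'| ‖y - y'‖ := by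
        gcongr
        · exact le_max_left _ _
        · exact le_max_right _ _
    _ = (Bt + L) * max |s - s'| ‖y - y'‖ := by ring

omit [DecidableEq d] in
/-- Sup bounds of a field jointly smooth on the compact slab `[0, T] × 𝕋^d` exist. [folklore] -/
theorem exists_bound_of_isSmoothSpaceTimeOn {F : Type*} [NormedAddCommGroup F] [NormedSpace ℝ F] (hT : 0 ≤ T)
    {u : ℝ → UnitAddTorus d → F} (hu : FunctionSpaces.Torus.IsSmoothSpaceTimeOn (Icc 0 T) u) :
    ∃ C, ∀ t ∈ Icc 0 T, ∀ x, ‖u t x‖ ≤ C := by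
  have hc := continuous_uncurry_clamp hT hu.continuousOn
  obtain ⟨C, hC⟩ := (isCompact_Icc.prod isCompact_univ : IsCompact (Icc (0 : ℝ) T ×ˢ (univ : Set (UnitAddTorus d)))).exists_bound_of_continuousOn
    hc.continuousOn
  refine ⟨C, fun t ht x => ?_⟩
  have h := hC (t, x) ⟨ht, mem_univ x⟩
  simpa [uncurry, projIcc_of_mem hT ht] using h

end SlabData

/-! ## The `H`-based bound on the time derivative of the mollified field -/

section TimeDerivH

variable {U : ℝ → UnitAddTorus d → EuclideanSpace ℝ d} {M H β T₀ τ ε : ℝ}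

omit [Fintype d] [DecidableEq d] in
/-- `∫ ρ_τ' = 0` for the normalised time bump. [folklore] -/
theorem integral_deriv_timeBump_normed (hτ : 0 < τ) : ∫ σ, deriv ((timeBump hτ).normed volume) σ = 0 :=
  integral_eq_zero_of_hasDerivAt_of_integrable
    (fun x => (((timeBump hτ).contDiff_normed (n := 1)).differentiable (by simp) x).hasDerivAt)
    (FunctionSpaces.Torus.integrable_deriv_timeBump_normed hτ) (timeBump hτ).integrable_normed

omit [DecidableEq d] in
/-- **`|∂ₜVᵢ(t, x)| ≤ c τ⁻¹ H (max τ ε)^β`** on windows inside the slab: the time derivative sees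
only the Hölder modulus of the data (re-centre at `Uᵢ(t, x)`, which costs nothing since `∫ρ' = 0`).
For Lipschitz data and `τ = ε = ℓ` this is the lossless `‖∂ₜv_ℓ‖ ≲ ‖v‖_{C¹}`. [cite: BuckmasterVicol2019Annals, §4.1 (4.7)] -/
theorem norm_timeDeriv_mollifiedField_apply_le_of_window (hU : HolderSlabData U M H β T₀) (hτ : 0 < τ)
    (hε : 0 < ε) (hε' : ε ≤ 1 / 4) {t : ℝ} (ht : Icc (t - τ) (t + τ) ⊆ Icc 0 T₀) (x : UnitAddTorus d) (i : d) :
    ‖FunctionSpaces.Torus.timeDeriv (mollifiedField (timeBump hτ) ε U) t x i‖ ≤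
      τ⁻¹ * timeBumpDerivMass * (H * max τ ε ^ β) := by
  have hUi : Integrable (uncurry U) ((volume : Measure ℝ).prod volume) :=
    integrable_uncurry_of_bounded hU.measurable hU.bound hU.zero_off
  have hk := FunctionSpaces.Torus.continuous_kernel (d := d) hε hε'
  rw [timeDeriv_mollifiedField_apply hU.measurable hUi hε hε']
  have hsub := FunctionSpaces.Torus.timeAvgWith_convolution_sub_const (stronglyMeasurable_uncurry_apply hU.measurable i)
    (hU.bound_apply i) (FunctionSpaces.Torus.integrable_deriv_timeBump_normed hτ) hk (U t x i) t x
  rw [integral_deriv_timeBump_normed hτ, zero_mul, mul_zero, sub_zero] at hsub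
  rw [← hsub]
  have h := FunctionSpaces.Torus.norm_timeAvgWith_convolution_le_of_window
    (h := fun s y => U s y i - U t x i) (FunctionSpaces.Torus.integrable_deriv_timeBump_normed hτ)
    (fun σ hσ => (FunctionSpaces.Torus.timeBump_normed_eq_zero hτ hσ).2) hk
    (fun z hz => FunctionSpaces.Torus.kernel_eq_zero_of_lt hε hz) (t := t) (x := x)
    (B := H * max τ ε ^ β) (fun s y hs hy => hU.norm_apply_sub_le_of_window ht hτ.le hs hy i)
  rwa [FunctionSpaces.Torus.integral_norm_deriv_timeBump_normed, FunctionSpaces.Torus.integral_norm_kernel_eq_one hε hε',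
    mul_one] at h

/-- Vector form: `‖∂ₜV(t, x)‖ ≤ d c τ⁻¹ H (max τ ε)^β` on windows inside the slab. [folklore] -/
theorem norm_timeDeriv_mollifiedField_le_of_window (hU : HolderSlabData U M H β T₀) (hτ : 0 < τ)
    (hε : 0 < ε) (hε' : ε ≤ 1 / 4) {t : ℝ} (ht : Icc (t - τ) (t + τ) ⊆ Icc 0 T₀) (x : UnitAddTorus d) :
    ‖FunctionSpaces.Torus.timeDeriv (mollifiedField (timeBump hτ) ε U) t x‖ ≤
      Fintype.card d * (τ⁻¹ * timeBumpDerivMass * (H * max τ ε ^ β)) := by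
  refine (norm_le_sum_norm_apply _).trans ?_
  calc ∑ k, ‖FunctionSpaces.Torus.timeDeriv (mollifiedField (timeBump hτ) ε U) t x k‖
      ≤ ∑ _k : d, τ⁻¹ * timeBumpDerivMass * (H * max τ ε ^ β) :=
        Finset.sum_le_sum fun k _ => norm_timeDeriv_mollifiedField_apply_le_of_window hU hτ hε hε' ht x k
    _ = _ := by rw [Finset.sum_const, Finset.card_univ, nsmul_eq_mul]

end TimeDerivH

/-! ## The `L¹` bound of mollified data -/

section L1

variable {W : ℝ → UnitAddTorus d → EuclideanSpace ℝ d} {φ : ContDiffBump (0 : ℝ)} {ε A T₀ L : ℝ}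

omit [DecidableEq d] in
/-- Young on the torus in `L¹` for a nonnegative continuous kernel: `∫|f ⋆ k| ≤ (∫ k) ∫|f|`. [folklore] -/
theorem integral_norm_convolution_le {f k : UnitAddTorus d → ℝ} (hf : Integrable f volume) (hk : Continuous k)
    (hk0 : ∀ z, 0 ≤ k z) : ∫ x, ‖(f ⋆ k) x‖ ≤ (∫ z, k z) * ∫ y, ‖f y‖ := by
  obtain ⟨Ck, hCk⟩ := FunctionSpaces.Torus.exists_forall_norm_le_of_continuous hk
  -- pointwise: `|(f ⋆ k)(x)| ≤ ∫ |f y| k(x - y) dy`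
  have hpt : ∀ x, ‖(f ⋆ k) x‖ ≤ ∫ y, ‖f y‖ * k (x - y) := by
    intro x
    rw [convolution_def]
    refine (norm_integral_le_integral_norm _).trans (le_of_eq (integral_congr_ae (Eventually.of_forall fun y => ?_)))
    simp only [lsmul_apply, smul_eq_mul, norm_mul, Real.norm_eq_abs, abs_of_nonneg (hk0 _)]
  -- Fubini for `(x, y) ↦ |f y| k(x - y)`
  set Φ : UnitAddTorus d × UnitAddTorus d → ℝ := fun q => ‖f q.2‖ * k (q.1 - q.2) with hΦ
  have hΦm : AEStronglyMeasurable Φ ((volume : Measure (UnitAddTorus d)).prod volume) :=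
    (hf.1.norm.comp_snd).mul (hk.comp (continuous_fst.sub continuous_snd)).aestronglyMeasurable
  have hΦi : Integrable Φ ((volume : Measure (UnitAddTorus d)).prod volume) := by
    have hdom : Integrable (fun q : UnitAddTorus d × UnitAddTorus d => ‖f q.2‖ * Ck) ((volume : Measure _).prod volume) :=
      (hf.norm.mul_const Ck).comp_snd volume
    refine hdom.mono' hΦm (Eventually.of_forall fun q => ?_)
    simp only [hΦ, norm_mul, norm_norm]
    exact mul_le_mul_of_nonneg_left (hCk _) (norm_nonneg _)
  calc ∫ x, ‖(f ⋆ k) x‖ ≤ ∫ x, ∫ y, ‖f y‖ * k (x - y) :=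
        integral_mono_of_nonneg (Eventually.of_forall fun x => norm_nonneg _) hΦi.integral_prod_left
          (Eventually.of_forall hpt)
    _ = ∫ y, ∫ x, ‖f y‖ * k (x - y) := integral_integral_swap hΦi
    _ = ∫ y, ‖f y‖ * ∫ z, k z := by
        refine integral_congr_ae (Eventually.of_forall fun y => ?_)
        show ∫ x, ‖f y‖ * k (x - y) = ‖f y‖ * ∫ z, k z
        rw [integral_const_mul, integral_sub_right_eq_self k y]
    _ = (∫ z, k z) * ∫ y, ‖f y‖ := by rw [integral_mul_const, mul_comm]

omit [DecidableEq d] in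
/-- **The `L¹` norm is not increased by space–time mollification**: if every slice of the data has
`∫‖Wᵢ(s)‖ ≤ L`, then `∫‖Vᵢ(t)‖ ≤ L` (`V = mollifiedField φ ε W`; Minkowski through the time average and
Young in space, `∫ρ = ∫k_ε = 1`). [cite: BuckmasterVicol2019Annals, §4.1 ("`R̊_ℓ` inherits the `L¹` bound of `R̊_q`")] -/
theorem integral_norm_mollifiedField_apply_le (hWm : StronglyMeasurable (uncurry W)) (hWb : ∀ s y, ‖W s y‖ ≤ A)
    (hW0 : ∀ s, s ∉ Icc 0 T₀ → W s = 0) (hε : 0 < ε) (hε' : ε ≤ 1 / 4) (i : d)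
    (hL : ∀ s, ∫ y, ‖W s y i‖ ≤ L) (t : ℝ) : ∫ x, ‖mollifiedField φ ε W t x i‖ ≤ L := by
  have hA : 0 ≤ A := (norm_nonneg _).trans (hWb 0 0)
  have hWi : Integrable (uncurry W) ((volume : Measure ℝ).prod volume) := integrable_uncurry_of_bounded hWm hWb hW0
  have hk : Continuous (kernel (d := d) ε) := FunctionSpaces.Torus.continuous_kernel hε hε'
  have hWim : StronglyMeasurable (uncurry fun s y => W s y i) := stronglyMeasurable_uncurry_apply hWm i
  have hWib : ∀ s y, ‖W s y i‖ ≤ A := fun s y => (PiLp.norm_apply_le (W s y) i).trans (hWb s y)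
  obtain ⟨hΘm, hΘb⟩ := stronglyMeasurable_convolution_slice hWim hWib hε hε'
  set ρ : ℝ → ℝ := φ.normed volume
  have hρ0 : ∀ s, 0 ≤ ρ s := fun s => φ.nonneg_normed s
  -- `Vᵢ(t, x) = ∫ ρ(s) (Wᵢ(t - s) ⋆ k)(x) ds`
  have h1 : ∀ x, mollifiedField φ ε W t x i = ∫ s, ρ s * ((fun y => W (t - s) y i) ⋆ kernel ε) x := fun x => by
    rw [mollifiedField_apply_eq_timeAvgWith hWi hε hε', FunctionSpaces.timeAvgWith_apply]
    simp only [smul_eq_mul]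
    rfl
  -- the slice `L¹` bound after spatial mollification
  have hsl : ∀ s, ∫ x, ‖((fun y => W s y i) ⋆ kernel ε) x‖ ≤ L := fun s => by
    have h := integral_norm_convolution_le ((integrable_slice hWm hWb s).eval_piLp i) hk
      (FunctionSpaces.Torus.kernel_nonneg hε.le)
    rw [FunctionSpaces.Torus.integral_kernel hε hε', one_mul] at h
    exact h.trans (hL s)
  -- Fubini for `(x, s) ↦ ρ(s) |(Wᵢ(t-s) ⋆ k)(x)|`
  set Φ : UnitAddTorus d × ℝ → ℝ := fun q => ρ q.2 * ‖((fun y => W (t - q.2) y i) ⋆ kernel ε) q.1‖ with hΦ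
  have hΘm' : StronglyMeasurable fun q : UnitAddTorus d × ℝ => ((fun y => W (t - q.2) y i) ⋆ kernel ε) q.1 :=
    hΘm.comp_measurable (((measurable_const (a := t)).sub measurable_snd).prodMk measurable_fst)
  have hΦm : AEStronglyMeasurable Φ ((volume : Measure (UnitAddTorus d)).prod volume) :=
    ((φ.continuous_normed.comp continuous_snd).aestronglyMeasurable).mul hΘm'.aestronglyMeasurable.norm
  have hΦi : Integrable Φ ((volume : Measure (UnitAddTorus d)).prod volume) := by
    have hdom : Integrable (fun q : UnitAddTorus d × ℝ => ‖ρ q.2‖ * A) ((volume : Measure _).prod volume) :=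
      (φ.integrable_normed.norm.mul_const A).comp_snd volume
    refine hdom.mono' hΦm (Eventually.of_forall fun q => ?_)
    simp only [hΦ, norm_mul, Real.norm_eq_abs, abs_abs]
    have hb := hΘb (t - q.2) q.1
    rw [Real.norm_eq_abs] at hb
    exact mul_le_mul_of_nonneg_left hb (abs_nonneg _)
  calc ∫ x, ‖mollifiedField φ ε W t x i‖ = ∫ x, ‖∫ s, ρ s * ((fun y => W (t - s) y i) ⋆ kernel ε) x‖ := by simp_rw [h1]
    _ ≤ ∫ x, ∫ s, Φ (x, s) := by
        refine integral_mono_of_nonneg (Eventually.of_forall fun x => norm_nonneg _) hΦi.integral_prod_left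
          (Eventually.of_forall fun x => (norm_integral_le_integral_norm _).trans (le_of_eq ?_))
        refine integral_congr_ae (Eventually.of_forall fun s => ?_)
        simp only [hΦ, norm_mul, Real.norm_eq_abs, abs_of_nonneg (hρ0 s)]
    _ = ∫ s, ∫ x, Φ (x, s) := integral_integral_swap hΦi
    _ = ∫ s, ρ s * ∫ x, ‖((fun y => W (t - s) y i) ⋆ kernel ε) x‖ := by
        refine integral_congr_ae (Eventually.of_forall fun s => ?_)
        show ∫ x, ρ s * ‖((fun y => W (t - s) y i) ⋆ kernel ε) x‖ = _
        exact integral_const_mul _ _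
    _ ≤ ∫ s, ρ s * L := by
        refine integral_mono ?_ (φ.integrable_normed.mul_const L) fun s => mul_le_mul_of_nonneg_left (hsl _) (hρ0 s)
        exact (hΦi.integral_prod_right).congr (Eventually.of_forall fun s => by
          show ∫ x, ρ s * ‖((fun y => W (t - s) y i) ⋆ kernel ε) x‖ = _
          exact integral_const_mul _ _)
    _ = L := by rw [integral_mul_const, φ.integral_normed, one_mul]

end L1

/-! ## Pointwise bounds from `L^∞` bounds; norms of tensors from entries -/

section Pointwise

omit [DecidableEq d] in
/-- **A continuous function on the torus is everywhere bounded by its `L^∞` norm** (an open set of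
positive Haar measure cannot be null). [folklore] -/
theorem norm_le_of_eLpNorm_top_le {F' : Type*} [NormedAddCommGroup F'] {f : UnitAddTorus d → F'} (hf : Continuous f)
    {C : ℝ} (hC0 : 0 ≤ C) (hC : eLpNorm f ∞ volume ≤ ENNReal.ofReal C) (x : UnitAddTorus d) : ‖f x‖ ≤ C := by
  by_contra hlt
  have hlt' : C < ‖f x‖ := not_le.1 hlt
  set U : Set (UnitAddTorus d) := {y | C < ‖f y‖} with hU
  have hUo : IsOpen U := isOpen_lt continuous_const hf.norm
  have hUpos : 0 < volume U := hUo.measure_pos volume ⟨x, hlt'⟩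
  have hae : ∀ᵐ y ∂(volume : Measure (UnitAddTorus d)), ‖f y‖ ≤ C := by
    have h1 := ae_le_eLpNormEssSup (f := f) (μ := (volume : Measure (UnitAddTorus d)))
    rw [← eLpNorm_exponent_top] at h1
    filter_upwards [h1] with y hy
    have hy' : ‖f y‖ₑ ≤ ENNReal.ofReal C := hy.trans hC
    rw [← ofReal_norm] at hy'
    exact (ENNReal.ofReal_le_ofReal_iff hC0).1 hy'
  have hU0 : volume U = 0 := by
    rw [hU]
    refine measure_eq_zero_iff_ae_notMem.2 ?_
    filter_upwards [hae] with y hy hyU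
    exact absurd hyU (not_lt.2 hy)
  exact absurd hU0 hUpos.ne'

omit [DecidableEq d] in
/-- `eLpNorm f ∞ ≤ ofReal C` from a pointwise bound. [folklore] -/
theorem eLpNorm_top_le_of_forall_norm_le {F' : Type*} [NormedAddCommGroup F'] {f : UnitAddTorus d → F'} {C : ℝ}
    (h : ∀ x, ‖f x‖ ≤ C) : eLpNorm f ∞ volume ≤ ENNReal.ofReal C := by
  rw [eLpNorm_exponent_top]
  exact eLpNormEssSup_le_of_ae_bound (Eventually.of_forall h)

/-- **The sup bound of the anti-divergence**: there is `K` (depending only on `d`) with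
`‖ℛv(x)‖ ≤ K sup‖v‖` for smooth `v` (the accepted `L^∞` bound `Torus.exists_eLpNorm_antidivergence_le`
at `p = ∞`, read pointwise). [folklore] -/
theorem exists_norm_antidivergence_le (hd : 2 ≤ Fintype.card d) :
    ∃ K : ℝ, 0 ≤ K ∧ ∀ (v : UnitAddTorus d → EuclideanSpace ℝ d), IsSmooth v → ∀ C : ℝ, 0 ≤ C → (∀ x, ‖v x‖ ≤ C) →
      ∀ x, ‖antidivergence v x‖ ≤ K * C := by
  obtain ⟨K, hK⟩ := exists_eLpNorm_antidivergence_le (d := d) hd (p := ∞) le_top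
  refine ⟨K, K.coe_nonneg, fun v hv C hC hb x => ?_⟩
  have h1 : eLpNorm (antidivergence v) ∞ volume ≤ ENNReal.ofReal (K * C) := by
    refine (hK v hv).trans ?_
    rw [ENNReal.ofReal_mul K.coe_nonneg, ENNReal.ofReal_coe_nnreal]
    exact mul_le_mul_right (eLpNorm_top_le_of_forall_norm_le hb) _
  exact norm_le_of_eLpNorm_top_le (isSmooth_antidivergence hv).continuous (mul_nonneg K.coe_nonneg hC) h1 x

/-- Norm of a tensor (by columns) from its entries: `‖w‖ ≤ d · max|w j i|`. [folklore] -/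
theorem pi_norm_le_of_forall_apply_apply_le {w : d → EuclideanSpace ℝ d} {c : ℝ} (hc : 0 ≤ c) (h : ∀ j i, ‖w j i‖ ≤ c) :
    ‖w‖ ≤ Fintype.card d * c := by
  refine (pi_norm_le_iff_of_nonneg (by positivity)).2 fun j => (norm_le_sum_norm_apply (w j)).trans ?_
  calc ∑ i, ‖w j i‖ ≤ ∑ _i : d, c := Finset.sum_le_sum fun i _ => h j i
    _ = Fintype.card d * c := by rw [Finset.sum_const, Finset.card_univ, nsmul_eq_mul]

/-- Norm of a vector from its coordinates: `‖w‖ ≤ d · max|w i|`. [folklore] -/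
theorem euclidean_norm_le_of_forall_apply_le {w : EuclideanSpace ℝ d} {c : ℝ} (h : ∀ i, ‖w i‖ ≤ c) :
    ‖w‖ ≤ Fintype.card d * c := by
  refine (norm_le_sum_norm_apply w).trans ?_
  calc ∑ i, ‖w i‖ ≤ ∑ _i : d, c := Finset.sum_le_sum fun i _ => h i
    _ = Fintype.card d * c := by rw [Finset.sum_const, Finset.card_univ, nsmul_eq_mul]

end Pointwise

/-! ## Entry bounds for the mollified stress of bounded data -/

section StressEntries

variable {RU : ℝ → UnitAddTorus d → d → EuclideanSpace ℝ d} {A T₀ τ ε : ℝ} {Hc : d → ℝ}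

/-- **`|∂ₗVᵢ| ≤ C₁ ε⁻¹ A`**: first space derivatives of mollified bounded data (sup version). [folklore] -/
theorem norm_partialDeriv_mollifiedField_apply_le_of_bound {U : ℝ → UnitAddTorus d → EuclideanSpace ℝ d} {M H β : ℝ}
    (hU : HolderSlabData U M H β T₀) (hτ : 0 < τ) (hε : 0 < ε) (hε' : ε ≤ 1 / 4) (t : ℝ) (x : UnitAddTorus d) (l i : d) :
    ‖FunctionSpaces.Torus.partialDeriv l (mollifiedField (timeBump hτ) ε U t) x i‖ ≤ ε⁻¹ * gradProfileMass d * M := by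
  have hk : IsSmooth (kernel (d := d) ε) := FunctionSpaces.Torus.isSmooth_kernel hε hε'
  rw [partialDeriv_mollifiedField_apply hU.measurable hU.bound hU.zero_off hε hε']
  have h := FunctionSpaces.Torus.norm_timeAvgWith_convolution_le_of_bound (hU.bound_apply i)
    (timeBump hτ).integrable_normed (hk.partialDeriv l).continuous t x
  rw [FunctionSpaces.Torus.integral_norm_timeBump_normed, one_mul] at h
  exact h.trans (mul_le_mul_of_nonneg_right (FunctionSpaces.Torus.integral_norm_partialDeriv_kernel_le hε hε' l) hU.M_nonneg)

variable [Nonempty d] (hcol : ∀ j, HolderSlabData (fun s y => RU s y j) A (Hc j) 1 T₀) (hτ : 0 < τ) (hε : 0 < ε)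
  (hε' : ε ≤ 1 / 4)
include hcol hτ hε hε'

/-- `‖ℛ_ℓ(s, x)‖ ≤ d A`. [folklore] -/
theorem norm_mollifiedStress_le (s : ℝ) (x : UnitAddTorus d) : ‖mollifiedStress (timeBump hτ) ε RU s x‖ ≤ Fintype.card d * A :=
  pi_norm_le_of_forall_apply_apply_le (hcol (Classical.arbitrary d)).M_nonneg fun j i =>
    norm_mollifiedField_apply_le (hcol j) hτ hε hε' s x i

omit [DecidableEq d] hτ hε hε' in
/-- Admissibility of the full tensor data from the columns. [folklore] -/
theorem stress_data : StronglyMeasurable (uncurry RU) ∧ (∀ s y, ‖RU s y‖ ≤ A) ∧ ∀ s, s ∉ Icc 0 T₀ → RU s = 0 := by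
  have hA : 0 ≤ A := (hcol (Classical.arbitrary d)).M_nonneg
  refine ⟨?_, fun s y => (pi_norm_le_iff_of_nonneg hA).2 fun j => (hcol j).bound s y, fun s hs => ?_⟩
  · have h : ∀ j, Measurable fun q : ℝ × UnitAddTorus d => RU q.1 q.2 j := fun j => (hcol j).measurable.measurable
    have e : uncurry RU = fun q : ℝ × UnitAddTorus d => fun j => RU q.1 q.2 j := by funext q; rfl
    rw [e]
    exact (measurable_pi_iff.2 h).stronglyMeasurable
  · funext y j
    have h := congrFun ((hcol j).zero_off s hs) y
    simpa using h

omit [DecidableEq d] in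
/-- `ℛ_ℓ(s)` is smooth. [folklore] -/
theorem isSmooth_mollifiedStress' (s : ℝ) : IsSmooth (mollifiedStress (timeBump hτ) ε RU s) := by
  obtain ⟨hm, hb, h0⟩ := stress_data hcol
  exact isSmooth_mollifiedStress hm hb h0 hε hε' s

/-- `‖∂ₗ ℛ_ℓ(s, x)‖ ≤ d C₁ ε⁻¹ A`. [folklore] -/
theorem norm_partialDeriv_mollifiedStress_le (s : ℝ) (x : UnitAddTorus d) (l : d) :
    ‖FunctionSpaces.Torus.partialDeriv l (mollifiedStress (timeBump hτ) ε RU s) x‖ ≤ Fintype.card d * (ε⁻¹ * gradProfileMass d * A) := by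
  have hS := isSmooth_mollifiedStress' hcol hτ hε hε' s
  refine pi_norm_le_of_forall_apply_apply_le ?_ fun j i => ?_
  · have hA : 0 ≤ A := (hcol (Classical.arbitrary d)).M_nonneg
    have := FunctionSpaces.Torus.gradProfileMass_nonneg (d := d)
    positivity
  · rw [partialDeriv_tensor_apply hS l x j]
    exact norm_partialDeriv_mollifiedField_apply_le_of_bound (hcol j) hτ hε hε' s x l i

/-- `‖∂ₗ∂ₘ ℛ_ℓ(s, x)‖ ≤ d C₂ ε⁻² A`. [folklore] -/
theorem norm_partialDeriv_partialDeriv_mollifiedStress_le (s : ℝ) (x : UnitAddTorus d) (l m : d) :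
    ‖FunctionSpaces.Torus.partialDeriv l (FunctionSpaces.Torus.partialDeriv m (mollifiedStress (timeBump hτ) ε RU s)) x‖ ≤
      Fintype.card d * ((ε ^ 2)⁻¹ * derivProfileMass d 2 * A) := by
  have hS := isSmooth_mollifiedStress' hcol hτ hε hε' s
  have e : FunctionSpaces.Torus.partialDeriv m (mollifiedStress (timeBump hτ) ε RU s) =
      fun y j => FunctionSpaces.Torus.partialDeriv m (fun z => mollifiedStress (timeBump hτ) ε RU s z j) y := by
    funext y j; exact partialDeriv_tensor_apply hS m y j
  refine pi_norm_le_of_forall_apply_apply_le ?_ fun j i => ?_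
  · have hA : 0 ≤ A := (hcol (Classical.arbitrary d)).M_nonneg
    have := FunctionSpaces.Torus.derivProfileMass_nonneg (d := d) 2
    positivity
  · have hS' : IsSmooth (FunctionSpaces.Torus.partialDeriv m (mollifiedStress (timeBump hτ) ε RU s)) := hS.partialDeriv m
    rw [partialDeriv_tensor_apply hS' l x j]
    have e' : (fun y => FunctionSpaces.Torus.partialDeriv m (mollifiedStress (timeBump hτ) ε RU s) y j) =
        FunctionSpaces.Torus.partialDeriv m (mollifiedField (timeBump hτ) ε (fun s' y => RU s' y j) s) := by
      funext y; rw [e]; rfl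
    rw [e']
    exact norm_partialDeriv_partialDeriv_mollifiedField_apply_le (hcol j) hτ hε hε' s x l m i

/-- **Time derivative of `ℛ_ℓ` along an affine time map**: `t ↦ ℛ_ℓ(κt + c, x)` has derivative
`κ • ∂ₜℛ_ℓ(κt + c, x)` with `‖∂ₜℛ_ℓ‖ ≤ d c τ⁻¹ A`. [folklore] -/
theorem hasDerivAt_mollifiedStress_comp_affine (κ c t : ℝ) (x : UnitAddTorus d) :
    ∃ D : d → EuclideanSpace ℝ d, HasDerivAt (fun s => mollifiedStress (timeBump hτ) ε RU (κ * s + c) x) (κ • D) t ∧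
      ‖D‖ ≤ Fintype.card d * (τ⁻¹ * timeBumpDerivMass * A) := by
  have hA : 0 ≤ A := (hcol (Classical.arbitrary d)).M_nonneg
  set D : d → EuclideanSpace ℝ d := fun j => FunctionSpaces.Torus.timeDeriv (mollifiedField (timeBump hτ) ε (fun s' y => RU s' y j)) (κ * t + c) x
  refine ⟨D, ?_, ?_⟩
  · refine hasDerivAt_pi.2 fun j => ?_
    have hg : ContDiff ℝ ∞ (stLift (mollifiedField (timeBump hτ) ε (fun s' y => RU s' y j))) :=
      contDiff_stLift_mollifiedField (integrable_uncurry_of_bounded (hcol j).measurable (hcol j).bound (hcol j).zero_off) hε hε'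
    have h := hasDerivAt_comp_affine hg κ c t x
    simpa [D, mollifiedStress_apply] using h
  · refine (pi_norm_le_iff_of_nonneg (by have := FunctionSpaces.Torus.timeBumpDerivMass_nonneg; positivity)).2 fun j => ?_
    exact euclidean_norm_le_of_forall_apply_le fun i => norm_timeDeriv_mollifiedField_apply_le (hcol j) hτ hε hε' _ x i

/-- **Time derivative of `∂ₗℛ_ℓ` along an affine time map**, with `‖∂ₜ∂ₗℛ_ℓ‖ ≤ d c τ⁻¹ C₁ ε⁻¹ A`. [folklore] -/
theorem hasDerivAt_partialDeriv_mollifiedStress_comp_affine (κ c t : ℝ) (x : UnitAddTorus d) (l : d) :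
    ∃ D : d → EuclideanSpace ℝ d,
      HasDerivAt (fun s => FunctionSpaces.Torus.partialDeriv l (mollifiedStress (timeBump hτ) ε RU (κ * s + c)) x) (κ • D) t ∧
      ‖D‖ ≤ Fintype.card d * (τ⁻¹ * timeBumpDerivMass * (ε⁻¹ * gradProfileMass d) * A) := by
  have hA : 0 ≤ A := (hcol (Classical.arbitrary d)).M_nonneg
  set D : d → EuclideanSpace ℝ d := fun j => WithLp.toLp 2 fun i =>
    timeAvgWith (deriv ((timeBump hτ).normed volume)) (fun s' => (fun y => RU s' y j i) ⋆
      FunctionSpaces.Torus.partialDeriv l (kernel ε)) (κ * t + c) x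
  have e : ∀ s, FunctionSpaces.Torus.partialDeriv l (mollifiedStress (timeBump hτ) ε RU s) x =
      fun j => FunctionSpaces.Torus.partialDeriv l (mollifiedField (timeBump hτ) ε (fun s' y => RU s' y j) s) x := fun s => by
    funext j; exact partialDeriv_tensor_apply (isSmooth_mollifiedStress' hcol hτ hε hε' s) l x j
  refine ⟨D, ?_, ?_⟩
  · simp_rw [e]
    refine hasDerivAt_pi.2 fun j => ?_
    have hcoord : ∀ i, HasDerivAt (fun s => FunctionSpaces.Torus.partialDeriv l (mollifiedField (timeBump hτ) ε (fun s' y => RU s' y j) (κ * s + c)) x i)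
        ((κ • D j) i) t := by
      intro i
      have hg := hasDerivAt_partialDeriv_mollifiedField_apply (φ := timeBump hτ) (hcol j).measurable (hcol j).bound (hcol j).zero_off
        hε hε' (κ * t + c) x l i
      have hf : HasDerivAt (fun s : ℝ => κ * s + c) κ t := by simpa using ((hasDerivAt_id t).const_mul κ).add_const c
      have h2 : HasDerivAt (fun s => FunctionSpaces.Torus.partialDeriv l (mollifiedField (timeBump hτ) ε (fun s' y => RU s' y j) (κ * s + c)) x i)
          (κ • timeAvgWith (deriv ((timeBump hτ).normed volume)) (fun s' => (fun y => RU s' y j i) ⋆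
            FunctionSpaces.Torus.partialDeriv l (kernel ε)) (κ * t + c) x) t := by
        have h := hg.scomp t hf
        exact h
      have e2 : (κ • D j) i = κ • timeAvgWith (deriv ((timeBump hτ).normed volume)) (fun s' => (fun y => RU s' y j i) ⋆
          FunctionSpaces.Torus.partialDeriv l (kernel ε)) (κ * t + c) x := by
        simp [D]
      rw [e2]
      exact h2
    have h3 := hasDerivAt_of_apply hcoord
    simpa using h3
  · refine (pi_norm_le_iff_of_nonneg (by
      have := FunctionSpaces.Torus.timeBumpDerivMass_nonneg; have := FunctionSpaces.Torus.gradProfileMass_nonneg (d := d); positivity)).2 fun j => ?_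
    refine euclidean_norm_le_of_forall_apply_le fun i => ?_
    have h := norm_timeDeriv_partialDeriv_mollifiedField_apply_le (hcol j) hτ hε hε' (κ * t + c) x l i
    rw [timeDeriv_partialDeriv_mollifiedField_apply (hcol j).measurable (hcol j).bound (hcol j).zero_off hε hε'] at h
    simpa [D] using h

end StressEntries

/-! ## The package: a mollified triple on the same interval, with all bounds -/

section Package

omit [DecidableEq d] in
/-- Linearity of the traceless part in the column-sum form. [folklore] -/
theorem traceless_add_apply' [DecidableEq d] (S S' : UnitAddTorus d → d → EuclideanSpace ℝ d) (x : UnitAddTorus d) (j : d) :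
    traceless (fun y j => S y j + S' y j) x j = traceless S x j + traceless S' x j := by
  rw [traceless_eq_comp, traceless_eq_comp S, traceless_eq_comp S']
  simp only [Function.comp_apply]
  rw [show (fun j => S x j + S' x j) = S x + S' x from rfl, map_add]
  rfl

/-- **Column slab data of the stress.** For a classical NSR triple with `‖R‖ ≤ A` on the slab, every
column of the zero-extended stress is Lipschitz slab data with sup bound `A` (the Lipschitz constant,
irrelevant downstream, comes from compactness). [folklore] -/
theorem exists_holderSlabData_stress_col {S : Set ℝ} {ν T A : ℝ} {v : ℝ → UnitAddTorus d → EuclideanSpace ℝ d}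
    {p : ℝ → UnitAddTorus d → ℝ} {R : ℝ → UnitAddTorus d → d → EuclideanSpace ℝ d} (h : IsNSReynoldsOn S ν v p R)
    (hS : Icc 0 T ⊆ S) (hT : 0 < T) (hA : ∀ t ∈ Icc 0 T, ∀ x, ‖R t x‖ ≤ A) (j : d) :
    ∃ Hj : ℝ, HolderSlabData (fun s y => zeroExt T R s y j) A Hj 1 T := by
  have hIcc := h.mono_Icc hS hT
  have hU' : UniqueDiffOn ℝ (Icc 0 T) := uniqueDiffOn_Icc hT
  have hcol : FunctionSpaces.Torus.IsSmoothSpaceTimeOn (Icc 0 T) (fun t y => R t y j) := isSmoothSpaceTimeOn_tensor_iff.1 hIcc.smooth_stress j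
  have hbd : ∀ i, ∃ C, ∀ t ∈ Icc 0 T, ∀ x, ‖FunctionSpaces.Torus.partialDeriv i (fun y => R t y j) x‖ ≤ C := fun i =>
    exists_bound_of_isSmoothSpaceTimeOn hT.le (hcol.partialDeriv hU' i)
  choose C hC using hbd
  obtain ⟨Ct, hCt⟩ := exists_bound_of_isSmoothSpaceTimeOn hT.le (hcol.timeDerivWithin hU')
  have h0 : ∀ t ∈ Icc 0 T, ∀ x, ‖R t x j‖ ≤ A := fun t ht x => (norm_le_pi_norm (R t x) j).trans (hA t ht x)
  have h1 : ∀ i, ∀ t ∈ Icc 0 T, ∀ x, ‖FunctionSpaces.Torus.partialDeriv i (fun y => R t y j) x‖ ≤ ∑ i, |C i| := fun i t ht x =>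
    (hC i t ht x).trans ((le_abs_self _).trans (Finset.single_le_sum (f := fun i => |C i|) (fun i _ => abs_nonneg _) (Finset.mem_univ i)))
  have ht' : ∀ t ∈ Icc 0 T, ∀ x, ‖FunctionSpaces.Torus.timeDerivWithin (Icc 0 T) (fun t y => R t y j) t x‖ ≤ |Ct| := fun t ht x =>
    (hCt t ht x).trans (le_abs_self _)
  have hdata := holderSlabData_zeroExt hT hcol h0 h1 ht' (Finset.sum_nonneg fun i _ => abs_nonneg _) (abs_nonneg _)
  have e : zeroExt T (fun t y => R t y j) = fun s y => zeroExt T R s y j := by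
    funext s y
    by_cases hs : s ∈ Icc 0 T
    · rw [zeroExt_of_mem _ hs, zeroExt_of_mem R hs]
    · rw [zeroExt_of_not_mem _ hs, zeroExt_of_not_mem R hs]; rfl
  rw [e] at hdata
  exact ⟨_, hdata⟩

set_option maxHeartbeats 1600000 in
/-- **The mollified triple on the same interval, with all bounds** (Buckmaster–Vicol 2019, §4.1
(4.2)–(4.7) read on `[0, T]` via the reparametrisation `τ(t) = 2ℓ + (1 - 4ℓ/T)t`). There is a constant
`C ≥ 1` depending only on `d` such that: for every classical NSR triple `(v, p, R)` with viscosity `ν` on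
`[0, T] × 𝕋^d` (`d ≥ 2`) with zero-mean velocity and bounds `‖v‖ ≤ B₀`, `‖∂ᵢv‖ ≤ B₁`, `‖∂ₜv‖ ≤ Bₜ`,
`‖R‖ ≤ A`, `∫‖R(t)‖ ≤ δ`, and every scale `0 < ℓ ≤ 1/4` with `8ℓ ≤ T`, there are `ṽ, p̃` and stresses
`R_c` (carried) and `M` (to be cancelled; symmetric) with `(vm, pm, R_c + M̊)` an NSR triple with viscosity
`ν` on `[0, T]`, `vm` of zero mean, and: `‖vm‖ ≤ C B₀`, `‖vm - v‖ ≤ C(Bₜ + B₁)ℓ`, `‖∂ᵢvm‖, ‖∂ₜvm‖ ≤ C(Bₜ + B₁)`,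
`‖R_c‖ ≤ C(B₀ + 1/T)(Bₜ + B₁)ℓ`, `∫‖M(t)‖ ≤ Cδ`, `‖M‖ ≤ CA`, `‖∂M‖, ‖∂ₜM‖ ≤ CAℓ⁻¹`,
`‖∂∂M‖, ‖∂ₜ∂M‖ ≤ CAℓ⁻²`. [cite: BuckmasterVicol2019Annals, §4.1 (4.2)–(4.7)] -/
theorem exists_mollified_nsr_package (hd : 2 ≤ Fintype.card d) :
    ∃ C : ℝ, 1 ≤ C ∧ ∀ (T ν : ℝ) (v : ℝ → UnitAddTorus d → EuclideanSpace ℝ d) (p : ℝ → UnitAddTorus d → ℝ)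
      (R : ℝ → UnitAddTorus d → d → EuclideanSpace ℝ d), IsNSReynoldsOn (Icc 0 T) ν v p R → 0 < T →
      (∀ t ∈ Icc 0 T, HasZeroMean (v t)) → ∀ (B₀ B₁ Bt A δ ℓ : ℝ),
      (∀ t ∈ Icc 0 T, ∀ x, ‖v t x‖ ≤ B₀) → (∀ i, ∀ t ∈ Icc 0 T, ∀ x, ‖FunctionSpaces.Torus.partialDeriv i (v t) x‖ ≤ B₁) →
      (∀ t ∈ Icc 0 T, ∀ x, ‖FunctionSpaces.Torus.timeDerivWithin (Icc 0 T) v t x‖ ≤ Bt) → 0 ≤ B₁ → 0 ≤ Bt →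
      (∀ t ∈ Icc 0 T, ∀ x, ‖R t x‖ ≤ A) → (∀ t ∈ Icc 0 T, ∫ x, ‖R t x‖ ≤ δ) → 0 < ℓ → ℓ ≤ 1 / 4 → 8 * ℓ ≤ T →
      ∃ (vm : ℝ → UnitAddTorus d → EuclideanSpace ℝ d) (pm : ℝ → UnitAddTorus d → ℝ)
        (Rc M : ℝ → UnitAddTorus d → d → EuclideanSpace ℝ d),
        IsNSReynoldsOn (Icc 0 T) ν vm pm (fun t x j => Rc t x j + traceless (M t) x j) ∧
        (∀ t ∈ Icc 0 T, HasZeroMean (vm t)) ∧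
        FunctionSpaces.Torus.IsSmoothSpaceTimeOn (Icc 0 T) Rc ∧ FunctionSpaces.Torus.IsSmoothSpaceTimeOn (Icc 0 T) M ∧
        (∀ t x (i j : d), M t x i j = M t x j i) ∧ (∀ t ∈ Icc 0 T, ∀ x (i j : d), Rc t x i j = Rc t x j i) ∧
        (∀ t x, ‖vm t x‖ ≤ C * B₀) ∧
        (∀ t ∈ Icc 0 T, ∀ x, ‖vm t x - v t x‖ ≤ C * (Bt + B₁) * ℓ) ∧
        (∀ t ∈ Icc 0 T, ∀ x i, ‖FunctionSpaces.Torus.partialDeriv i (vm t) x‖ ≤ C * (Bt + B₁)) ∧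
        (∀ t ∈ Icc 0 T, ∀ x, ‖FunctionSpaces.Torus.timeDerivWithin (Icc 0 T) vm t x‖ ≤ C * (Bt + B₁)) ∧
        (∀ t ∈ Icc 0 T, ∀ x, ‖Rc t x‖ ≤ C * (B₀ + 1 / T) * (Bt + B₁) * ℓ) ∧
        (∀ t, ∫ x, ‖M t x‖ ≤ C * δ) ∧
        (∀ t x, ‖M t x‖ ≤ C * A) ∧
        (∀ t x l, ‖FunctionSpaces.Torus.partialDeriv l (M t) x‖ ≤ C * A * ℓ⁻¹) ∧
        (∀ t x l m, ‖FunctionSpaces.Torus.partialDeriv l (FunctionSpaces.Torus.partialDeriv m (M t)) x‖ ≤ C * A * ℓ⁻¹ ^ 2) ∧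
        (∀ t ∈ Icc 0 T, ∀ x, ‖FunctionSpaces.Torus.timeDerivWithin (Icc 0 T) M t x‖ ≤ C * A * ℓ⁻¹) ∧
        (∀ t ∈ Icc 0 T, ∀ x l, ‖FunctionSpaces.Torus.timeDerivWithin (Icc 0 T)
          (fun s y => FunctionSpaces.Torus.partialDeriv l (M s) y) t x‖ ≤ C * A * ℓ⁻¹ ^ 2) := by
  haveI : Nonempty d := Fintype.card_pos_iff.1 (by omega)
  obtain ⟨K, hK0, hK⟩ := exists_norm_antidivergence_le (d := d) hd
  -- the constants
  set cd : ℝ := (Fintype.card d : ℝ) with hcd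
  set mT : ℝ := timeBumpDerivMass with hmT
  set g₁ : ℝ := gradProfileMass d with hg₁
  set g₂ : ℝ := derivProfileMass d 2 with hg₂
  obtain ⟨L, hLdef⟩ : ∃ L : ℝ, L = 1 + Real.sqrt cd * cd := ⟨_, rfl⟩
  have hcd1 : 1 ≤ cd := by
    have : 1 ≤ Fintype.card d := Fintype.card_pos
    rw [hcd]; exact_mod_cast this
  have hcd0 : 0 ≤ cd := by linarith
  have hmT0 : 0 ≤ mT := FunctionSpaces.Torus.timeBumpDerivMass_nonneg
  have hg₁0 : 0 ≤ g₁ := FunctionSpaces.Torus.gradProfileMass_nonneg (d := d)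
  have hg₂0 : 0 ≤ g₂ := FunctionSpaces.Torus.derivProfileMass_nonneg (d := d) 2
  have hL1 : 1 ≤ L := by
    have : 0 ≤ Real.sqrt cd * cd := by positivity
    rw [hLdef]; linarith
  have hL0 : 0 ≤ L := by linarith
  obtain ⟨C, hCdef⟩ : ∃ C : ℝ, C = 1 + cd + (cd + 6) * L + cd * g₁ * L + cd * mT * L + (4 * (cd + 1) * cd * L + 4 * K * cd * mT * L) +
    cd * cd + cd * g₁ + cd * g₂ + cd * mT + cd * mT * g₁ := ⟨_, rfl⟩
  have hpos : 0 ≤ cd ∧ 0 ≤ (cd + 6) * L ∧ 0 ≤ cd * g₁ * L ∧ 0 ≤ cd * mT * L ∧ 0 ≤ 4 * (cd + 1) * cd * L + 4 * K * cd * mT * L ∧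
      0 ≤ cd * cd ∧ 0 ≤ cd * g₁ ∧ 0 ≤ cd * g₂ ∧ 0 ≤ cd * mT ∧ 0 ≤ cd * mT * g₁ := by
    refine ⟨hcd0, by positivity, by positivity, by positivity, by positivity, by positivity, by positivity, by positivity,
      by positivity, by positivity⟩
  obtain ⟨p1, p2, p3, p4, p5, p6, p7, p8, p9, p10⟩ := hpos
  have q1 : cd ≤ C := by rw [hCdef]; linarith
  have q2 : (cd + 6) * L ≤ C := by rw [hCdef]; linarith
  have q3 : cd * g₁ * L ≤ C := by rw [hCdef]; linarith
  have q4 : cd * mT * L ≤ C := by rw [hCdef]; linarith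
  have q5 : 4 * (cd + 1) * cd * L + 4 * K * cd * mT * L ≤ C := by rw [hCdef]; linarith
  have q6 : cd * cd ≤ C := by rw [hCdef]; linarith
  have q7 : cd * g₁ ≤ C := by rw [hCdef]; linarith
  have q8 : cd * g₂ ≤ C := by rw [hCdef]; linarith
  have q9 : cd * mT ≤ C := by rw [hCdef]; linarith
  have q10 : cd * mT * g₁ ≤ C := by rw [hCdef]; linarith
  have hC1 : 1 ≤ C := by rw [hCdef]; linarith
  refine ⟨C, hC1, ?_⟩
  intro T ν v p R h hT hvmean B₀ B₁ Bt A δ ℓ h0 h1 ht hB₁ hBt hA hδ hℓ hℓ4 hℓT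
  -- parameters of the mollification
  have hℓT' : ℓ < T := by linarith
  set κ : ℝ := 1 - 4 * ℓ / T with hκdef
  set c : ℝ := 2 * ℓ with hcdef'
  have hκ0 : 0 ≤ κ := by
    rw [hκdef, sub_nonneg, div_le_one hT]; linarith
  have hκ1 : κ ≤ 1 := by
    have : 0 ≤ 4 * ℓ / T := by positivity
    rw [hκdef]; linarith
  have hκabs : |κ| ≤ 1 := abs_le.2 ⟨by linarith, hκ1⟩
  have hκm1 : |κ - 1| = 4 * ℓ / T := by
    rw [hκdef, show (1 - 4 * ℓ / T - 1 : ℝ) = -(4 * ℓ / T) by ring, abs_neg, abs_of_nonneg (by positivity)]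
  have hτt : ∀ t ∈ Icc (0 : ℝ) T, 2 * ℓ ≤ κ * t + c ∧ κ * t + c ≤ T - 2 * ℓ := by
    intro t ht'
    refine ⟨by nlinarith [ht'.1], ?_⟩
    have h1' : κ * t ≤ κ * T := mul_le_mul_of_nonneg_left ht'.2 hκ0
    have h2' : κ * T = T - 4 * ℓ := by rw [hκdef]; field_simp
    linarith
  have hwin : ∀ t ∈ Icc (0 : ℝ) T, κ * t + c ∈ Ioo (timeBump hℓ).rOut (T - (timeBump hℓ).rOut) := by
    intro t ht'
    rw [FunctionSpaces.Torus.timeBump_rOut]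
    obtain ⟨a1, a2⟩ := hτt t ht'
    exact ⟨by linarith, by linarith⟩
  have hwin' : ∀ t ∈ Icc (0 : ℝ) T, Icc (κ * t + c - ℓ) (κ * t + c + ℓ) ⊆ Icc 0 T := by
    intro t ht' s hs
    obtain ⟨a1, a2⟩ := hτt t ht'
    exact ⟨by linarith [hs.1], by linarith [hs.2]⟩
  have hdist : ∀ t ∈ Icc (0 : ℝ) T, |κ * t + c - t| ≤ 6 * ℓ := by
    intro t ht'
    have e : κ * t + c - t = 2 * ℓ - 4 * ℓ / T * t := by rw [hκdef, hcdef']; ring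
    rw [e]
    have h1' : 0 ≤ 4 * ℓ / T * t := by have := ht'.1; positivity
    have h2' : 4 * ℓ / T * t ≤ 4 * ℓ := by
      have : t / T ≤ 1 := (div_le_one hT).2 ht'.2
      have e' : 4 * ℓ / T * t = 4 * ℓ * (t / T) := by ring
      rw [e']; nlinarith
    rw [abs_le]; constructor <;> linarith
  -- data
  obtain ⟨⟨hUm, hUb, hU0, hUdiv⟩, ⟨hRUm, hRUb, hRU0, hRUsym⟩⟩ := zeroExt_data h Subset.rfl hT h0 hA
  set U := zeroExt T v with hUdef
  set RU := zeroExt T R with hRUdef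
  have hUi := integrable_uncurry_of_bounded hUm hUb hU0
  have hU' : UniqueDiffOn ℝ (Icc 0 T) := uniqueDiffOn_Icc hT
  have hcv : Convex ℝ (Icc (0 : ℝ) T) := convex_Icc 0 T
  have hint : (interior (Icc (0 : ℝ) T)).Nonempty := by rw [interior_Icc]; exact nonempty_Ioo.2 hT
  have hUv : HolderSlabData U B₀ (Bt + Real.sqrt (Fintype.card d) * Fintype.card d * B₁) 1 T :=
    holderSlabData_zeroExt hT h.smooth_velocity h0 h1 ht hB₁ hBt
  set H : ℝ := Bt + Real.sqrt (Fintype.card d) * Fintype.card d * B₁ with hHdef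
  have hH0 : 0 ≤ H := hUv.H_nonneg
  have hHL : H ≤ L * (Bt + B₁) := by
    rw [hHdef, hLdef]
    have : 0 ≤ Real.sqrt cd * cd := by positivity
    nlinarith
  have hcolx : ∀ j, ∃ Hj : ℝ, HolderSlabData (fun s y => RU s y j) A Hj 1 T := fun j =>
    exists_holderSlabData_stress_col h Subset.rfl hT hA j
  choose Hc hcol using hcolx
  have hUmean : ∀ s, HasZeroMean (U s) := fun s => by
    by_cases hs : s ∈ Icc 0 T
    · rw [hUdef, zeroExt_of_mem v hs]; exact hvmean s hs
    · rw [hUdef, zeroExt_of_not_mem v hs]; show ∫ x, (0 : UnitAddTorus d → EuclideanSpace ℝ d) x = 0; simp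
  -- the pressure and the triple
  obtain ⟨q, hq, hgrad, hqmean⟩ := exists_pressure_mollifiedNSRResidual (φ := timeBump hℓ) h Subset.rfl hT h0 hA hℓ hℓ4
  have hNSR := isNSReynoldsOn_reparam (φ := timeBump hℓ) hd h Subset.rfl hT h0 hA hℓ hℓ4 hq hgrad hqmean hT hwin
  -- global smoothness of the mollified objects
  have hVg : ContDiff ℝ ∞ (stLift (mollifiedField (timeBump hℓ) ℓ U)) := contDiff_stLift_mollifiedField hUi hℓ hℓ4
  have hdVg : ContDiff ℝ ∞ (stLift (FunctionSpaces.Torus.timeDeriv (mollifiedField (timeBump hℓ) ℓ U))) :=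
    (isSpaceTimeTest_mollifiedField (φ := timeBump hℓ) hUi hℓ hℓ4 hU0).timeDeriv.1
  have hFlg : ∀ j, ContDiff ℝ ∞ (stLift fun t x => mollifiedFlux (timeBump hℓ) ℓ U t x j) := fun j =>
    contDiff_stLift_mollifiedField (integrable_uncurry_smul_apply hUm hUb hU0 j) hℓ hℓ4
  have hStg : ∀ j, ContDiff ℝ ∞ (stLift fun t x => mollifiedStress (timeBump hℓ) ℓ RU t x j) := fun j =>
    contDiff_stLift_mollifiedStress_col hRUm hRUb hRU0 hℓ hℓ4 j
  -- the four objects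
  set V := mollifiedField (timeBump hℓ) ℓ U with hVdef
  set vm := reparamVelocity (timeBump hℓ) ℓ T κ c v with hvmdef
  set M : ℝ → UnitAddTorus d → d → EuclideanSpace ℝ d := fun t => mollifiedStress (timeBump hℓ) ℓ RU (κ * t + c) with hMdef
  set comm : ℝ → UnitAddTorus d → d → EuclideanSpace ℝ d := fun t y j =>
    tensorProd (V (κ * t + c)) (V (κ * t + c)) y j - mollifiedFlux (timeBump hℓ) ℓ U (κ * t + c) y j with hcommdef
  set Rc : ℝ → UnitAddTorus d → d → EuclideanSpace ℝ d := fun t x j =>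
    traceless (comm t) x j + antidivergence (reparamDefect (timeBump hℓ) ℓ T κ c v t) x j with hRcdef
  -- smoothness on `[0, T]`
  have hVs : FunctionSpaces.Torus.IsSmoothSpaceTimeOn (Icc 0 T) (fun t => V (κ * t + c)) :=
    isSmoothSpaceTimeOn_comp_affine_of_contDiff hVg _ κ c
  have hFls : FunctionSpaces.Torus.IsSmoothSpaceTimeOn (Icc 0 T) (fun t => mollifiedFlux (timeBump hℓ) ℓ U (κ * t + c)) :=
    isSmoothSpaceTimeOn_tensor_iff.2 fun j => isSmoothSpaceTimeOn_comp_affine_of_contDiff (hFlg j) _ κ c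
  have hMs : FunctionSpaces.Torus.IsSmoothSpaceTimeOn (Icc 0 T) M :=
    isSmoothSpaceTimeOn_tensor_iff.2 fun j => isSmoothSpaceTimeOn_comp_affine_of_contDiff (hStg j) _ κ c
  have hcomms : FunctionSpaces.Torus.IsSmoothSpaceTimeOn (Icc 0 T) comm := (hVs.tensorProd hVs).sub hFls
  have hdefs : FunctionSpaces.Torus.IsSmoothSpaceTimeOn (Icc 0 T) (reparamDefect (timeBump hℓ) ℓ T κ c v) :=
    (isSmoothSpaceTimeOn_comp_affine_of_contDiff hdVg _ κ c).const_smul (κ - 1)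
  have hRcs : FunctionSpaces.Torus.IsSmoothSpaceTimeOn (Icc 0 T) Rc := hcomms.traceless.add (hdefs.antidivergence hcv hint)
  -- the stress of the triple is `Rc + M̊`
  have hstress : reparamStress (timeBump hℓ) ℓ T κ c v R = fun t x j => Rc t x j + traceless (M t) x j := by
    funext t x j
    have e1 : nsrRaw (timeBump hℓ) ℓ T v R (κ * t + c) = fun y j => comm t y j + M t y j := by
      funext y j; simp only [nsrRaw, hcommdef, hMdef, hVdef, hUdef, hRUdef]
    simp only [reparamStress, hRcdef, e1, traceless_add_apply']
    abel
  refine ⟨vm, reparamPressure (timeBump hℓ) ℓ T κ c v R q, Rc, M, hstress ▸ hNSR, fun t _ => ?_, hRcs, hMs,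
    fun t x i j => ?_, fun t ht' x i j => ?_, ?_⟩
  · exact hasZeroMean_mollifiedField hUm hUb hU0 hUmean hℓ hℓ4 _
  · exact mollifiedStress_symm hRUm hRUb hRU0 hRUsym hℓ hℓ4 _ x i j
  · have hcsym : ∀ i j, comm t x i j = comm t x j i := fun i j => by
      simp only [hcommdef, PiLp.sub_apply, tensorProd, PiLp.smul_apply, smul_eq_mul, hVdef]
      rw [mollifiedFlux_symm hUm hUb hU0 hℓ hℓ4 _ x i j]; ring
    simp only [hRcdef, PiLp.add_apply]
    rw [traceless_symm (fun i j => hcsym i j) i j, antidivergence_symm (hdefs.isSmooth_slice ht') x i j]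
  -- the bounds
  obtain ⟨hb1, hb2, -⟩ := norm_mollifiedField_bounds hUv hℓ hℓ hℓ4
  have hmax : max ℓ ℓ = ℓ := max_self ℓ
  refine ⟨fun t x => ?_, fun t ht' x => ?_, fun t ht' x i => ?_, fun t ht' x => ?_, fun t ht' x => ?_, fun t => ?_, fun t x => ?_,
    fun t x l => ?_, fun t x l m => ?_, fun t ht' x => ?_, fun t ht' x l => ?_⟩
  · -- `‖vm‖ ≤ cd B₀`
    have hB0 : 0 ≤ B₀ := hUv.M_nonneg
    calc ‖vm t x‖ = ‖V (κ * t + c) x‖ := rfl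
      _ ≤ cd * B₀ := hb1 (κ * t + c) x
      _ ≤ C * B₀ := mul_le_mul_of_nonneg_right q1 hB0
  · -- `‖vm - v‖`
    have hτI : κ * t + c ∈ Icc (0 : ℝ) T := by obtain ⟨a1, a2⟩ := hτt t ht'; exact ⟨by linarith, by linarith⟩
    have e1 : vm t x - v t x = (V (κ * t + c) x - U (κ * t + c) x) + (v (κ * t + c) x - v t x) := by
      rw [hUdef, zeroExt_of_mem v hτI]; simp [hvmdef, reparamVelocity, hVdef, hUdef]
    have h2' : ‖V (κ * t + c) x - U (κ * t + c) x‖ ≤ cd * (H * ℓ) := by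
      have h := hb2 (κ * t + c) (hwin' t ht') x
      rwa [hmax, Real.rpow_one] at h
    have h3' : ‖v (κ * t + c) x - v t x‖ ≤ H * (6 * ℓ) := by
      have h := hUv.holder (κ * t + c) hτI t ht' x x
      rw [hUdef, zeroExt_of_mem v hτI, zeroExt_of_mem v ht', sub_self, norm_zero, Real.rpow_one,
        max_eq_left (abs_nonneg _)] at h
      exact h.trans (mul_le_mul_of_nonneg_left (hdist t ht') hH0)
    calc ‖vm t x - v t x‖ ≤ cd * (H * ℓ) + H * (6 * ℓ) := by rw [e1]; exact (norm_add_le _ _).trans (add_le_add h2' h3')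
      _ = (cd + 6) * H * ℓ := by ring
      _ ≤ (cd + 6) * (L * (Bt + B₁)) * ℓ := by gcongr
      _ = ((cd + 6) * L) * (Bt + B₁) * ℓ := by ring
      _ ≤ C * (Bt + B₁) * ℓ := by gcongr
  · -- `‖∂ᵢvm‖`
    have h := norm_partialDeriv_mollifiedField_le hUv hℓ hℓ hℓ4 (hwin' t ht') x i
    rw [hmax, Real.rpow_one] at h
    calc ‖FunctionSpaces.Torus.partialDeriv i (vm t) x‖ ≤ cd * (ℓ⁻¹ * g₁ * (H * ℓ)) := h
      _ = cd * g₁ * H := by field_simp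
      _ ≤ cd * g₁ * (L * (Bt + B₁)) := by gcongr
      _ = (cd * g₁ * L) * (Bt + B₁) := by ring
      _ ≤ C * (Bt + B₁) := by gcongr
  · -- `‖∂ₜvm‖`
    have hψ : ContDiff ℝ ∞ (stLift vm) := by
      have hφ : ContDiff ℝ ∞ (fun z : ℝ × EuclideanSpace ℝ d => (κ * z.1 + c, z.2)) :=
        ((contDiff_const.mul contDiff_fst).add contDiff_const).prodMk contDiff_snd
      change ContDiff ℝ ∞ (stLift (mollifiedField (timeBump hℓ) ℓ U) ∘ fun z : ℝ × EuclideanSpace ℝ d => (κ * z.1 + c, z.2))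
      exact hVg.comp hφ
    have e1 : FunctionSpaces.Torus.timeDerivWithin (Icc 0 T) vm t x = κ • FunctionSpaces.Torus.timeDeriv V (κ * t + c) x := by
      rw [FunctionSpaces.Torus.timeDerivWithin_eq_timeDeriv_of_contDiff hψ hU' ht' x, FunctionSpaces.Torus.timeDeriv,
        show (fun s' => vm s' x) = fun s' => mollifiedField (timeBump hℓ) ℓ U (κ * s' + c) x from rfl,
        (hasDerivAt_comp_affine hVg κ c t x).deriv]
    have h := norm_timeDeriv_mollifiedField_le_of_window hUv hℓ hℓ hℓ4 (hwin' t ht') x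
    rw [hmax, Real.rpow_one] at h
    rw [e1, norm_smul, Real.norm_eq_abs]
    calc |κ| * ‖FunctionSpaces.Torus.timeDeriv V (κ * t + c) x‖ ≤ 1 * (cd * (ℓ⁻¹ * mT * (H * ℓ))) :=
          mul_le_mul hκabs h (norm_nonneg _) zero_le_one
      _ = cd * mT * H := by field_simp
      _ ≤ cd * mT * (L * (Bt + B₁)) := by gcongr
      _ = (cd * mT * L) * (Bt + B₁) := by ring
      _ ≤ C * (Bt + B₁) := by gcongr
  · -- `‖Rc‖`
    have hB0 : 0 ≤ B₀ := hUv.M_nonneg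
    -- the commutator
    have hce : ∀ j i, ‖comm t x j i‖ ≤ 4 * B₀ * H * ℓ := fun j i => by
      have h := norm_mollifiedFlux_sub_mul_le hUv hℓ hℓ hℓ4 (hwin' t ht') x j i
      rw [hmax, Real.rpow_one] at h
      simp only [hcommdef, PiLp.sub_apply, tensorProd, PiLp.smul_apply, smul_eq_mul, hVdef]
      rw [← norm_neg, neg_sub]; exact h
    have hcn : ‖comm t x‖ ≤ cd * (4 * B₀ * H * ℓ) := pi_norm_le_of_forall_apply_apply_le (by positivity) hce
    have htr : ‖traceless (comm t) x‖ ≤ (cd + 1) * (cd * (4 * B₀ * H * ℓ)) := by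
      rw [traceless_eq_comp, Function.comp_apply]
      exact (norm_tracelessCLM_le _).trans (mul_le_mul_of_nonneg_left hcn (by positivity))
    -- the defect
    have hdn : ∀ y, ‖reparamDefect (timeBump hℓ) ℓ T κ c v t y‖ ≤ 4 * ℓ / T * (cd * (mT * H)) := fun y => by
      have h := norm_timeDeriv_mollifiedField_le_of_window hUv hℓ hℓ hℓ4 (hwin' t ht') y
      rw [hmax, Real.rpow_one] at h
      simp only [reparamDefect]
      rw [norm_smul, Real.norm_eq_abs, hκm1, ← hUdef]
      have e2 : cd * (ℓ⁻¹ * mT * (H * ℓ)) = cd * (mT * H) := by field_simp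
      exact mul_le_mul_of_nonneg_left (h.trans e2.le) (by positivity)
    have han : ‖antidivergence (reparamDefect (timeBump hℓ) ℓ T κ c v t) x‖ ≤ K * (4 * ℓ / T * (cd * (mT * H))) :=
      hK _ (hdefs.isSmooth_slice ht') _ (by positivity) hdn x
    have e1 : Rc t x = traceless (comm t) x + antidivergence (reparamDefect (timeBump hℓ) ℓ T κ c v t) x := by
      funext j; simp [hRcdef]
    rw [e1]
    calc ‖traceless (comm t) x + antidivergence (reparamDefect (timeBump hℓ) ℓ T κ c v t) x‖
        ≤ (cd + 1) * (cd * (4 * B₀ * H * ℓ)) + K * (4 * ℓ / T * (cd * (mT * H))) := (norm_add_le _ _).trans (add_le_add htr han)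
      _ = (4 * (cd + 1) * cd) * B₀ * H * ℓ + (4 * K * cd * mT) * (1 / T) * H * ℓ := by ring
      _ ≤ (4 * (cd + 1) * cd * L) * B₀ * (Bt + B₁) * ℓ + (4 * K * cd * mT * L) * (1 / T) * (Bt + B₁) * ℓ := by
          have a1 : (4 * (cd + 1) * cd) * B₀ * H * ℓ ≤ (4 * (cd + 1) * cd) * B₀ * (L * (Bt + B₁)) * ℓ := by gcongr
          have a2 : (4 * K * cd * mT) * (1 / T) * H * ℓ ≤ (4 * K * cd * mT) * (1 / T) * (L * (Bt + B₁)) * ℓ := by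
            have : 0 ≤ 4 * K * cd * mT * (1 / T) := by positivity
            gcongr
          nlinarith
      _ ≤ (4 * (cd + 1) * cd * L + 4 * K * cd * mT * L) * (B₀ + 1 / T) * (Bt + B₁) * ℓ := by
          have hT1 : 0 ≤ 1 / T := by positivity
          have hBB : 0 ≤ Bt + B₁ := by positivity
          nlinarith [mul_nonneg (mul_nonneg (mul_nonneg p5 hB0) hBB) hℓ.le, mul_nonneg (mul_nonneg (mul_nonneg p5 hT1) hBB) hℓ.le,
            mul_nonneg (mul_nonneg (by positivity : (0:ℝ) ≤ 4 * (cd + 1) * cd * L) hT1) hBB,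
            mul_nonneg (mul_nonneg (by positivity : (0:ℝ) ≤ 4 * K * cd * mT * L) hB0) hBB]
      _ ≤ C * (B₀ + 1 / T) * (Bt + B₁) * ℓ := by
          have hT1 : 0 ≤ B₀ + 1 / T := by positivity
          gcongr
  · -- `∫‖M‖ ≤ cd² δ`
    have hδ' : ∀ j i s, ∫ y, ‖RU s y j i‖ ≤ δ := by
      intro j i s
      by_cases hs : s ∈ Icc 0 T
      · have hRs : IsSmooth (R s) := h.smooth_stress.isSmooth_slice hs
        calc ∫ y, ‖RU s y j i‖ ≤ ∫ y, ‖R s y‖ := by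
              refine integral_mono (((continuous_apply j).comp hRs.continuous).norm.integrable_unitAddTorus.mono' ?_ ?_)
                hRs.continuous.norm.integrable_unitAddTorus fun y => ?_
              · exact ((continuous_euclidean_apply ((continuous_apply j).comp hRs.continuous) i).norm).aestronglyMeasurable.congr
                  (Eventually.of_forall fun y => by simp [hRUdef, zeroExt_of_mem R hs])
              · exact Eventually.of_forall fun y => by
                  rw [norm_norm, hRUdef, zeroExt_of_mem R hs]; exact (PiLp.norm_apply_le (R s y j) i).trans (le_of_eq rfl) |>.trans le_rfl
              · show ‖RU s y j i‖ ≤ ‖R s y‖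
                rw [hRUdef, zeroExt_of_mem R hs]
                exact (PiLp.norm_apply_le (R s y j) i).trans (norm_le_pi_norm (R s y) j)
          _ ≤ δ := hδ s hs
      · have hδ0 : 0 ≤ δ := le_trans (integral_nonneg fun y => norm_nonneg _) (hδ 0 ⟨le_rfl, hT.le⟩)
        simp only [hRUdef, zeroExt_of_not_mem R hs, Pi.zero_apply, PiLp.zero_apply, norm_zero, integral_zero]
        exact hδ0
    have hMc : Continuous (M t) := (isSmooth_mollifiedStress' hcol hℓ hℓ hℓ4 (κ * t + c)).continuous
    have hent : ∀ j i, ∫ x, ‖M t x j i‖ ≤ δ := fun j i =>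
      integral_norm_mollifiedField_apply_le (φ := timeBump hℓ) (hcol j).measurable (hcol j).bound (hcol j).zero_off hℓ hℓ4 i (hδ' j i) _
    have hδ0 : 0 ≤ δ := le_trans (integral_nonneg fun y => norm_nonneg _) (hent (Classical.arbitrary d) (Classical.arbitrary d))
    calc ∫ x, ‖M t x‖ ≤ ∫ x, ∑ j, ∑ i, ‖M t x j i‖ :=
          integral_mono hMc.norm.integrable_unitAddTorus (by fun_prop : Continuous fun x => ∑ j, ∑ i, ‖M t x j i‖).integrable_unitAddTorus
            fun x => norm_tensor_le_sum_sum_abs (M t x)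
      _ = ∑ j, ∑ i, ∫ x, ‖M t x j i‖ := by
          rw [integral_finsetSum _ fun j _ => (by fun_prop : Continuous fun x => ∑ i, ‖M t x j i‖).integrable_unitAddTorus]
          refine Finset.sum_congr rfl fun j _ => integral_finsetSum _ fun i _ => ?_
          exact (continuous_euclidean_apply ((continuous_apply j).comp hMc) i).norm.integrable_unitAddTorus
      _ ≤ ∑ _j : d, ∑ _i : d, δ := Finset.sum_le_sum fun j _ => Finset.sum_le_sum fun i _ => hent j i
      _ = cd * cd * δ := by simp only [Finset.sum_const, Finset.card_univ, nsmul_eq_mul, hcd]; ring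
      _ ≤ C * δ := mul_le_mul_of_nonneg_right q6 hδ0
  · -- `‖M‖`
    have hA0 : 0 ≤ A := (hcol (Classical.arbitrary d)).M_nonneg
    calc ‖M t x‖ ≤ cd * A := norm_mollifiedStress_le hcol hℓ hℓ hℓ4 (κ * t + c) x
      _ ≤ C * A := mul_le_mul_of_nonneg_right q1 hA0
  · -- `‖∂M‖`
    have hA0 : 0 ≤ A := (hcol (Classical.arbitrary d)).M_nonneg
    calc ‖FunctionSpaces.Torus.partialDeriv l (M t) x‖ ≤ cd * (ℓ⁻¹ * g₁ * A) := norm_partialDeriv_mollifiedStress_le hcol hℓ hℓ hℓ4 (κ * t + c) x l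
      _ = (cd * g₁) * A * ℓ⁻¹ := by ring
      _ ≤ C * A * ℓ⁻¹ := by gcongr
  · -- `‖∂∂M‖`
    have hA0 : 0 ≤ A := (hcol (Classical.arbitrary d)).M_nonneg
    calc ‖FunctionSpaces.Torus.partialDeriv l (FunctionSpaces.Torus.partialDeriv m (M t)) x‖ ≤ cd * ((ℓ ^ 2)⁻¹ * g₂ * A) :=
          norm_partialDeriv_partialDeriv_mollifiedStress_le hcol hℓ hℓ hℓ4 (κ * t + c) x l m
      _ = (cd * g₂) * A * ℓ⁻¹ ^ 2 := by rw [inv_pow]; ring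
      _ ≤ C * A * ℓ⁻¹ ^ 2 := by gcongr
  · -- `‖∂ₜM‖`
    have hA0 : 0 ≤ A := (hcol (Classical.arbitrary d)).M_nonneg
    obtain ⟨D, hD, hDb⟩ := hasDerivAt_mollifiedStress_comp_affine hcol hℓ hℓ hℓ4 κ c t x
    have e1 : FunctionSpaces.Torus.timeDerivWithin (Icc 0 T) M t x = κ • D := by
      show derivWithin (fun s => M s x) (Icc 0 T) t = κ • D
      exact hD.hasDerivWithinAt.derivWithin (hU' t ht')
    rw [e1, norm_smul, Real.norm_eq_abs]
    calc |κ| * ‖D‖ ≤ 1 * (cd * (ℓ⁻¹ * mT * A)) := mul_le_mul hκabs hDb (norm_nonneg _) zero_le_one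
      _ = (cd * mT) * A * ℓ⁻¹ := by ring
      _ ≤ C * A * ℓ⁻¹ := by gcongr
  · -- `‖∂ₜ∂M‖`
    have hA0 : 0 ≤ A := (hcol (Classical.arbitrary d)).M_nonneg
    obtain ⟨D, hD, hDb⟩ := hasDerivAt_partialDeriv_mollifiedStress_comp_affine hcol hℓ hℓ hℓ4 κ c t x l
    have e1 : FunctionSpaces.Torus.timeDerivWithin (Icc 0 T) (fun s y => FunctionSpaces.Torus.partialDeriv l (M s) y) t x = κ • D := by
      show derivWithin (fun s => FunctionSpaces.Torus.partialDeriv l (M s) x) (Icc 0 T) t = κ • D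
      exact hD.hasDerivWithinAt.derivWithin (hU' t ht')
    rw [e1, norm_smul, Real.norm_eq_abs]
    calc |κ| * ‖D‖ ≤ 1 * (cd * (ℓ⁻¹ * mT * (ℓ⁻¹ * g₁) * A)) := mul_le_mul hκabs hDb (norm_nonneg _) zero_le_one
      _ = (cd * mT * g₁) * A * ℓ⁻¹ ^ 2 := by ring
      _ ≤ C * A * ℓ⁻¹ ^ 2 := by gcongr

end Package

end Torus

end Literature.Analysis.FluidPDE
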